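import Summits.ABC.ABC.Theorems.IsogenyGlueCongruenceEllipticGluingPrimeBoundStubMinkowski
import Summits.ABC.ABC.Theorems.IsogenyGlueCongruenceEllipticGluingPrimeBoundStubBigImageTorsionCore
import Mathlib
import HarnessLib

/-!
# Crux `EllipticGluingPrimeBound`, line SketchIdeator5 — stub `stub_abelianKernelMinkowskiCore`
# (the algebraic core of the endomorphism-field-abelian slice)

Stub `stub_abelianKernelMinkowskiCore` of line `SketchIdeator5` (slices of the free branch
`U_simple`) of crux U `Summit.ABC.ABC.Theses.IsogenyGlueCongruence.EllipticGluingPrimeBound`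
(item stmt-ABC-13919), registered signature (namespace `Summit.ABC.ABC.Theorems.GluingSlices`).

**Statement.** Let `ℓ ≥ 5` be prime, let a group `Γ` act `ℤ`-linearly (`ρ`) with finitely many
values on a free `ℤ`-lattice `H` of finite rank, and ONTO (`π`) the automorphism group of an
abelian group `V` with `#V = ℓ²`, `ℓ V = 0`.  If any two elements of `{σ | ρ σ = 1}` act on `V`
through commuting automorphisms, then `ℓ ≤ rank H + 1`.

**Proof.** `K := ker ρ` (as a hom to `Aut_ℤ(H)`), `G := Aut(V)`, `N := π(K)`: a normal (`π` onto)
abelian (hypothesis) subgroup of `G`.  `V` is a plane over `𝔽_ℓ`, so a basis gives an injective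
hom `Ψ : GL₂(𝔽_ℓ) → G`; the unipotent `U = (1 1; 0 1)` has `U ^ ℓ = 1` and does not commute with
its conjugate `(1 0; 1 1)` by the swap `S`, so `u := Ψ U ∉ N` (else `u` and `s u s⁻¹ ∈ N` would
commute), hence `u` has order exactly `ℓ` in `G ⧸ N` and `ℓ ∣ [G : N] ∣ [Γ : K] = #ρ(Γ)`.  The
finite group `ρ(Γ)` is a subgroup of `GL_m(ℤ)`, `m = rank H`
(`BigImage.exists_subgroup_generalLinearGroup_mulEquiv`), and Minkowski (`stub_minkowski`) gives
`ℓ ≤ m + 1`.  (K4 `stub_abelianNormalCentral` — `N` is even central — is not needed: the single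
commutator check above replaces it.)  Pure algebra over the tree's landed theorems; no cited
facts, no definitions.
-/

noncomputable section

-- `Summit.<Summit>.<Problem>` is the mandated summit-side namespace (CONVENTIONS §2); for the
-- single-conjunct summit `ABC` the two coincide, so the duplicate `ABC.ABC` is deliberate.
set_option linter.dupNamespace false

namespace Summit.ABC.ABC.Theorems.GluingSlices

open Summit.ABC.ABC.Theorems.IsotypicMinkowski

/-- **Order-`ℓ` survivor modulo an abelian normal subgroup.** If `N ⊴ G` is abelian, `u ^ ℓ = 1`
(`ℓ` prime) and `u` fails to commute with some conjugate `s u s⁻¹`, then `u ∉ N`, so the image of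
`u` in `G ⧸ N` has order `ℓ`, whence `ℓ ∣ [G : N]`. -/
theorem prime_dvd_index_of_not_commute_conj {G : Type*} [Group G] {ℓ : ℕ} [Fact ℓ.Prime]
    (N : Subgroup G) [hN : N.Normal] (hab : ∀ x ∈ N, ∀ y ∈ N, x * y = y * x) (u s : G)
    (hu : u ^ ℓ = 1) (hus : u * (s * u * s⁻¹) ≠ s * u * s⁻¹ * u) : ℓ ∣ N.index := by
  have hnot : u ∉ N := fun h ↦ hus (hab u h _ (hN.conj_mem u h s))
  have hord : orderOf (QuotientGroup.mk u : G ⧸ N) = ℓ := by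
    refine orderOf_eq_prime ?_ ?_
    · rw [← QuotientGroup.mk_pow, hu, QuotientGroup.mk_one]
    · intro h
      exact hnot ((QuotientGroup.eq_one_iff u).mp h)
  rw [Subgroup.index_eq_card, ← hord]
  exact orderOf_dvd_natCard _

/-- **The two matrices.** In `GL₂(ℤ/ℓ)` (`ℓ` prime) the unipotent `U = (1 1; 0 1)` satisfies
`U ^ ℓ = 1` and does not commute with its conjugate `(1 0; 1 1)` by the swap `S = (0 1; 1 0)`
(the `(1,1)` entries of the two products are `2` and `1`). -/
theorem exists_unipotent_swap (ℓ : ℕ) [Fact ℓ.Prime] :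
    ∃ U S : Matrix.GeneralLinearGroup (Fin 2) (ZMod ℓ),
      U ^ ℓ = 1 ∧ U * (S * U * S⁻¹) ≠ S * U * S⁻¹ * U := by
  let U : GL (Fin 2) (ZMod ℓ) :=
    ⟨!![1, 1; 0, 1], !![1, -1; 0, 1],
      by simp [Matrix.one_fin_two],
      by simp [Matrix.one_fin_two]⟩
  let S : GL (Fin 2) (ZMod ℓ) :=
    ⟨!![0, 1; 1, 0], !![0, 1; 1, 0],
      by simp [Matrix.one_fin_two],
      by simp [Matrix.one_fin_two]⟩
  have hUv : ((U : GL (Fin 2) (ZMod ℓ)) : Matrix (Fin 2) (Fin 2) (ZMod ℓ)) = !![1, 1; 0, 1] := rfl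
  have hSv : ((S : GL (Fin 2) (ZMod ℓ)) : Matrix (Fin 2) (Fin 2) (ZMod ℓ)) = !![0, 1; 1, 0] := rfl
  have hSi : ((S⁻¹ : GL (Fin 2) (ZMod ℓ)) : Matrix (Fin 2) (Fin 2) (ZMod ℓ)) = !![0, 1; 1, 0] := rfl
  -- powers of the unipotent
  have hpow : ∀ k : ℕ, ((U ^ k : GL (Fin 2) (ZMod ℓ)) : Matrix (Fin 2) (Fin 2) (ZMod ℓ)) =
      !![1, (k : ZMod ℓ); 0, 1] := by
    intro k
    induction k with
    | zero => simp [Matrix.one_fin_two]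
    | succ k ih =>
      rw [pow_succ, Units.val_mul, ih, hUv]
      simp
      ring
  refine ⟨U, S, ?_, ?_⟩
  · apply Units.ext
    rw [hpow, ZMod.natCast_self, Units.val_one, Matrix.one_fin_two]
  · intro h
    have h' := congrArg (fun g : GL (Fin 2) (ZMod ℓ) ↦ (g : Matrix (Fin 2) (Fin 2) (ZMod ℓ)) 0 0) h
    simp only [Units.val_mul, hUv, hSv, hSi] at h'
    simp at h'

/-- **Matrices act on the plane `V`.** For a `ℤ/ℓ`-module `V` with `#V = ℓ²` (`ℓ` prime), `V`
is a plane over `ℤ/ℓ`, and a basis yields an injective group homomorphism `GL₂(ℤ/ℓ) → Aut(V)`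
(matrix ↦ invertible linear map ↦ its underlying additive automorphism). -/
theorem exists_generalLinearGroup_hom_injective {ℓ : ℕ} [Fact ℓ.Prime] (V : Type)
    [AddCommGroup V] [Module (ZMod ℓ) V] (hcard : Nat.card V = ℓ ^ 2) :
    ∃ Ψ : Matrix.GeneralLinearGroup (Fin 2) (ZMod ℓ) →* Multiplicative (AddAut V),
      Function.Injective Ψ := by
  classical
  have hprime : ℓ.Prime := Fact.out
  haveI : Finite V :=
    Nat.finite_of_card_ne_zero (by rw [hcard]; exact pow_ne_zero _ hprime.ne_zero)
  haveI : Module.Finite (ZMod ℓ) V := Module.Finite.of_finite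
  have hrank : Module.finrank (ZMod ℓ) V = 2 := by
    have h := Module.natCard_eq_pow_finrank (K := ZMod ℓ) (V := V)
    rw [hcard, Nat.card_zmod] at h
    exact (Nat.pow_right_injective hprime.two_le h).symm
  let bV := Module.finBasisOfFinrankEq (ZMod ℓ) V hrank
  -- matrix ↦ invertible linear map
  let Φ₁ : Matrix.GeneralLinearGroup (Fin 2) (ZMod ℓ) →* (V →ₗ[ZMod ℓ] V)ˣ :=
    Units.map (Matrix.toLinAlgEquiv bV).toMulEquiv.toMonoidHom
  -- invertible linear map ↦ additive automorphism
  let Φ₂ : (V →ₗ[ZMod ℓ] V)ˣ →* Multiplicative (AddAut V) :=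
    DistribMulAction.toAddAut (V →ₗ[ZMod ℓ] V)ˣ V
  refine ⟨Φ₂.comp Φ₁, ?_⟩
  have h1 : Function.Injective Φ₁ :=
    Units.map_injective (Matrix.toLinAlgEquiv bV).toMulEquiv.injective
  have h2 : Function.Injective Φ₂ := by
    intro x y hxy
    apply Units.ext
    apply LinearMap.ext
    intro v
    have h := AddEquiv.congr_fun hxy v
    simpa [Φ₂, DistribMulAction.toAddAut_apply, DistribMulAction.toAddEquiv_apply,
      Units.smul_def, Module.End.smul_def] using h
  exact h2.comp h1

/-- **Registered stub `stub_abelianKernelMinkowskiCore`** (algebraic core of the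
endomorphism-field-abelian slice of `U_simple`, signature verbatim): a finite-image `ℤ`-linear
action `ρ` of `Γ` on a lattice `H`, a surjection `π` of `Γ` onto `Aut(V)` with `#V = ℓ²`,
`ℓ V = 0`, `ℓ ≥ 5` prime, and `π({ρ = 1})` abelian force `ℓ ≤ rank H + 1`. -/
theorem stub_abelianKernelMinkowskiCore :
    ∀ (ℓ : ℕ) [Fact ℓ.Prime], 5 ≤ ℓ →
      ∀ {Γ H V : Type} [Group Γ] [AddCommGroup H] [Module.Free ℤ H] [Module.Finite ℤ H]
        [AddCommGroup V], Nat.card V = ℓ ^ 2 → (∀ v : V, (ℓ : ℤ) • v = 0) →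
        ∀ (ρ : Representation ℤ Γ H), (Set.range ρ).Finite →
        ∀ (π : Γ →* Multiplicative (AddAut V)), Function.Surjective π →
        (∀ σ τ : Γ, ρ σ = 1 → ρ τ = 1 → π σ * π τ = π τ * π σ) →
          ℓ ≤ Module.finrank ℤ H + 1 := by
  intro ℓ _ h5 Γ H V _ _ _ _ _ hcard htor ρ hfin π hπ hcomm
  have hprime : ℓ.Prime := Fact.out
  -- `V` is a `ℤ/ℓ`-module; `GL₂(ℤ/ℓ) ↪ Aut(V)` and the two matrices
  haveI : Module (ZMod ℓ) V :=
    AddCommGroup.zmodModule fun v ↦ by rw [← natCast_zsmul]; exact htor v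
  obtain ⟨Ψ, hΨ⟩ := exists_generalLinearGroup_hom_injective V hcard
  obtain ⟨U, S, hUℓ, hUS⟩ := exists_unipotent_swap ℓ
  -- `K = ker ρ`, `N = π(K)`: normal and abelian
  let K : Subgroup Γ := ρ.asGroupHom.ker
  let N : Subgroup (Multiplicative (AddAut V)) := K.map π
  haveI : N.Normal := Subgroup.Normal.map inferInstance π hπ
  have hker : ∀ σ ∈ K, ρ σ = 1 := fun σ hσ ↦ by
    rw [← Representation.asGroupHom_apply, MonoidHom.mem_ker.mp hσ, Units.val_one]
  have hNab : ∀ x ∈ N, ∀ y ∈ N, x * y = y * x := by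
    rintro _ ⟨σ, hσ, rfl⟩ _ ⟨τ, hτ, rfl⟩
    exact hcomm σ τ (hker σ hσ) (hker τ hτ)
  -- `ℓ ∣ [G : N] ∣ [Γ : K] = #ρ(Γ)`
  have hdvdN : ℓ ∣ N.index := by
    refine prime_dvd_index_of_not_commute_conj N hNab (Ψ U) (Ψ S) ?_ ?_
    · rw [← map_pow, hUℓ, map_one]
    · intro h
      apply hUS
      apply hΨ
      simpa only [map_mul, map_inv] using h
  have hdvdK : ℓ ∣ K.index := hdvdN.trans (Subgroup.index_map_dvd (H := K) hπ)
  have hK : K.index = Nat.card ρ.asGroupHom.range := Subgroup.index_ker ρ.asGroupHom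
  rw [hK] at hdvdK
  -- `ρ(Γ) ≤ GL_m(ℤ)` finite; Minkowski
  haveI : Finite ρ.asGroupHom.range := BigImage.finite_range_asGroupHom ρ hfin
  obtain ⟨G, ⟨e⟩⟩ := BigImage.exists_subgroup_generalLinearGroup_mulEquiv ρ
  haveI : Finite G := Finite.of_equiv _ e.toEquiv
  rw [Nat.card_congr e.toEquiv] at hdvdK
  exact stub_minkowski _ ℓ hprime G hdvdK

end Summit.ABC.ABC.Theorems.GluingSlices

end
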